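import Literature.NumberTheory.LFunctions.KMVExactAFEAllOrdersProofs
import HarnessLib

/-!
# Route `PrimeLevelFamEdge`, crux K_A `MomentsBeyondDiagonal` (stmt-Parity-20007), line «petersson_layers» v4:
# the two-order AFE weight `W_{ij}(q̂; n₁, n₂)` — LOG-SEPARATED and POLYNOMIAL decay bounds (inputs for porting the
# `Q = 1` box / off-box estimates `…DictionaryAtOneBoxError`, `…IdentificationAtOne` §1 to every `Q`)

The tree's all-order decay `KMV2000.norm_afeW_le` reads
`‖W_{ij}(q̂;n₁,n₂)‖ ≤ C_{A,i}C_{A,j} (q̂²/n₁n₂)^A (1+|log q̂/n₁|)^i (1+|log q̂/n₂|)^j`. The `Q = 1` estimates use `W = W₀₀` through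
`W(y) ≤ 2k!·y^{−k/2}` only; at orders `(i,j)` the log factors are separated and absorbed here:
* `one_add_abs_log_div_le`: `1+|log(q̂/n)| ≤ (1+log q̂)(1+log n)` (`q̂, n ≥ 1`);
* `one_add_log_pow_le_rpow`: `(1+log x)^i ≤ (1+ε⁻¹)^i x^{εi}` (`x ≥ 1`, `ε > 0`);
* `norm_afeW_le_logsep`: `‖W_{ij}‖ ≤ C_{A,i}C_{A,j} (q̂²/n₁n₂)^A (1+log q̂)^{i+j} (1+log n₁)^i (1+log n₂)^j` (`q̂ ≥ 1`);
* `norm_afeW_le_rpow`: `‖W_{ij}‖ ≤ C_{A,i}C_{A,j}(1+ε⁻¹)^{i+j} (1+log q̂)^{i+j} (q̂²/n₁n₂)^A n₁^{εi} n₂^{εj}` — pure powers of `n₁, n₂`,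
  so the `Q = 1` arithmetic (`weight_mul_rpow_le`, `weight_offBox_le`) ports with `A` raised by `ε(i+j)` and a `(1+log q̂)^{i+j}` factor
  (harmless against the margins `q̂²`, `q̂` of `norm_boxSum_le`, `norm_offBoxTsum_le`).
Proof only; nothing about Landau–Siegel zeros; K_A NOT proved.
-/

noncomputable section

open scoped Real
open Set MeasureTheory
open Literature.NumberTheory.LFunctions Literature.NumberTheory.LFunctions.KMV2000

namespace Summit.Parity.GeneralizedHardyLittlewood.Theorems.MomentsBeyondDiagonal.TwoOrderAFE

/-- `1 + |log(q̂/n)| ≤ (1 + log q̂)(1 + log n)` for `q̂ ≥ 1`, `n ≥ 1`. -/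
theorem one_add_abs_log_div_le {qh : ℝ} (hqh : 1 ≤ qh) {n : ℕ} (hn : n ≠ 0) :
    1 + |Real.log (qh / n)| ≤ (1 + Real.log qh) * (1 + Real.log n) := by
  have hn1 : (1 : ℝ) ≤ n := by exact_mod_cast Nat.one_le_iff_ne_zero.mpr hn
  have hq0 : 0 < qh := by linarith
  have hn0 : (0 : ℝ) < n := by linarith
  rw [Real.log_div hq0.ne' hn0.ne']
  have ha : 0 ≤ Real.log qh := Real.log_nonneg hqh
  have hb : 0 ≤ Real.log n := Real.log_nonneg hn1
  have h1 : |Real.log qh - Real.log n| ≤ Real.log qh + Real.log n := by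
    rw [abs_le]; constructor <;> linarith
  nlinarith

/-- `(1 + log x)^i ≤ (1 + ε⁻¹)^i · x^{ε i}` for `x ≥ 1`, `ε > 0` (`log x ≤ x^ε/ε`). -/
theorem one_add_log_pow_le_rpow {ε : ℝ} (hε : 0 < ε) (i : ℕ) {x : ℝ} (hx : 1 ≤ x) :
    (1 + Real.log x) ^ i ≤ (1 + ε⁻¹) ^ i * x ^ (ε * i) := by
  have hx0 : 0 ≤ x := by linarith
  have hl : Real.log x ≤ x ^ ε / ε := Real.log_le_rpow_div hx0 hε
  have hxe : 1 ≤ x ^ ε := Real.one_le_rpow hx hε.le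
  have h1 : 1 + Real.log x ≤ (1 + ε⁻¹) * x ^ ε := by
    rw [div_eq_mul_inv] at hl
    have : 0 < ε⁻¹ := inv_pos.mpr hε
    nlinarith
  have h0 : 0 ≤ 1 + Real.log x := by linarith [Real.log_nonneg hx]
  calc (1 + Real.log x) ^ i ≤ ((1 + ε⁻¹) * x ^ ε) ^ i := pow_le_pow_left₀ h0 h1 i
    _ = (1 + ε⁻¹) ^ i * (x ^ ε) ^ i := mul_pow _ _ _
    _ = (1 + ε⁻¹) ^ i * x ^ (ε * i) := by rw [← Real.rpow_natCast (x ^ ε) i, ← Real.rpow_mul hx0]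

/-- **Log-separated decay of the two-order weight**: for `q̂ ≥ 1`, `A ≥ 0`, `n₁, n₂ ≥ 1`,
`‖W_{ij}(q̂;n₁,n₂)‖ ≤ C_{A,i}C_{A,j} · (q̂²/n₁n₂)^A · (1+log q̂)^{i+j} (1+log n₁)^i (1+log n₂)^j`,
`C_{A,i} = ∫_0^∞ x^A e^{−x} 2^i(1+|log x|^i) dx`. [cite: KowalskiMichelVanderKam2000, (22) p. 12 and (15) p. 9] -/
theorem norm_afeW_le_logsep {qh : ℝ} (hqh : 1 ≤ qh) (i j : ℕ) {A : ℝ} (hA : 0 ≤ A) {n₁ n₂ : ℕ}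
    (hn₁ : n₁ ≠ 0) (hn₂ : n₂ ≠ 0) :
    ‖afeW qh i j n₁ n₂‖ ≤
      ((∫ x in Ioi (0 : ℝ), x ^ A * (Real.exp (-x) * (2 ^ i * (1 + |Real.log x| ^ i)))) *
        ∫ x in Ioi (0 : ℝ), x ^ A * (Real.exp (-x) * (2 ^ j * (1 + |Real.log x| ^ j)))) *
      (qh ^ 2 / ((n₁ : ℝ) * n₂)) ^ A *
      ((1 + Real.log qh) ^ (i + j) * (1 + Real.log n₁) ^ i * (1 + Real.log n₂) ^ j) := by
  have hq0 : 0 < qh := by linarith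
  have h := norm_afeW_le hq0 i j hA hn₁ hn₂
  have hC₁ : 0 ≤ ∫ x in Ioi (0 : ℝ), x ^ A * (Real.exp (-x) * (2 ^ i * (1 + |Real.log x| ^ i))) :=
    setIntegral_nonneg measurableSet_Ioi fun x hx ↦ by have hx : (0 : ℝ) < x := hx; positivity
  have hC₂ : 0 ≤ ∫ x in Ioi (0 : ℝ), x ^ A * (Real.exp (-x) * (2 ^ j * (1 + |Real.log x| ^ j))) :=
    setIntegral_nonneg measurableSet_Ioi fun x hx ↦ by have hx : (0 : ℝ) < x := hx; positivity
  have hy : 0 ≤ (qh ^ 2 / ((n₁ : ℝ) * n₂)) ^ A := Real.rpow_nonneg (by positivity) A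
  have hl₁ := one_add_abs_log_div_le hqh hn₁
  have hl₂ := one_add_abs_log_div_le hqh hn₂
  have ha₁ : 0 ≤ 1 + |Real.log (qh / n₁)| := by positivity
  have ha₂ : 0 ≤ 1 + |Real.log (qh / n₂)| := by positivity
  have hp₁ : (1 + |Real.log (qh / n₁)|) ^ i ≤ ((1 + Real.log qh) * (1 + Real.log n₁)) ^ i :=
    pow_le_pow_left₀ ha₁ hl₁ i
  have hp₂ : (1 + |Real.log (qh / n₂)|) ^ j ≤ ((1 + Real.log qh) * (1 + Real.log n₂)) ^ j :=
    pow_le_pow_left₀ ha₂ hl₂ j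
  have hprod : (1 + |Real.log (qh / n₁)|) ^ i * (1 + |Real.log (qh / n₂)|) ^ j ≤
      (1 + Real.log qh) ^ (i + j) * (1 + Real.log n₁) ^ i * (1 + Real.log n₂) ^ j := by
    calc (1 + |Real.log (qh / n₁)|) ^ i * (1 + |Real.log (qh / n₂)|) ^ j
        ≤ ((1 + Real.log qh) * (1 + Real.log n₁)) ^ i * ((1 + Real.log qh) * (1 + Real.log n₂)) ^ j :=
          mul_le_mul hp₁ hp₂ (pow_nonneg ha₂ j) ((pow_nonneg ha₁ i).trans hp₁)
      _ = (1 + Real.log qh) ^ (i + j) * (1 + Real.log n₁) ^ i * (1 + Real.log n₂) ^ j := by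
          rw [mul_pow, mul_pow, pow_add]; ring
  calc ‖afeW qh i j n₁ n₂‖ ≤ _ := h
    _ = ((∫ x in Ioi (0 : ℝ), x ^ A * (Real.exp (-x) * (2 ^ i * (1 + |Real.log x| ^ i)))) *
          ∫ x in Ioi (0 : ℝ), x ^ A * (Real.exp (-x) * (2 ^ j * (1 + |Real.log x| ^ j)))) *
        (qh ^ 2 / ((n₁ : ℝ) * n₂)) ^ A *
        ((1 + |Real.log (qh / n₁)|) ^ i * (1 + |Real.log (qh / n₂)|) ^ j) := by ring
    _ ≤ _ := mul_le_mul_of_nonneg_left hprod (mul_nonneg (mul_nonneg hC₁ hC₂) hy)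

/-- **Polynomial decay of the two-order weight**: for `q̂ ≥ 1`, `A ≥ 0`, `ε > 0`, `n₁, n₂ ≥ 1`,
`‖W_{ij}(q̂;n₁,n₂)‖ ≤ C_{A,i}C_{A,j}(1+ε⁻¹)^{i+j} (1+log q̂)^{i+j} · (q̂²/n₁n₂)^A · n₁^{εi} n₂^{εj}` — the shape in which the `Q = 1`
weight arithmetic (`W(y) ≤ 2k!y^{−k/2}`) ports to orders `(i,j)`. [cite: KowalskiMichelVanderKam2000, (22) p. 12 and (15) p. 9] -/
theorem norm_afeW_le_rpow {qh : ℝ} (hqh : 1 ≤ qh) (i j : ℕ) {A : ℝ} (hA : 0 ≤ A) {ε : ℝ} (hε : 0 < ε)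
    {n₁ n₂ : ℕ} (hn₁ : n₁ ≠ 0) (hn₂ : n₂ ≠ 0) :
    ‖afeW qh i j n₁ n₂‖ ≤
      ((∫ x in Ioi (0 : ℝ), x ^ A * (Real.exp (-x) * (2 ^ i * (1 + |Real.log x| ^ i)))) *
        ∫ x in Ioi (0 : ℝ), x ^ A * (Real.exp (-x) * (2 ^ j * (1 + |Real.log x| ^ j)))) *
      (1 + ε⁻¹) ^ (i + j) * (1 + Real.log qh) ^ (i + j) *
      ((qh ^ 2 / ((n₁ : ℝ) * n₂)) ^ A * ((n₁ : ℝ) ^ (ε * i) * (n₂ : ℝ) ^ (ε * j))) := by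
  have h := norm_afeW_le_logsep hqh i j hA hn₁ hn₂
  have hn₁1 : (1 : ℝ) ≤ n₁ := by exact_mod_cast Nat.one_le_iff_ne_zero.mpr hn₁
  have hn₂1 : (1 : ℝ) ≤ n₂ := by exact_mod_cast Nat.one_le_iff_ne_zero.mpr hn₂
  have hC₁ : 0 ≤ ∫ x in Ioi (0 : ℝ), x ^ A * (Real.exp (-x) * (2 ^ i * (1 + |Real.log x| ^ i))) :=
    setIntegral_nonneg measurableSet_Ioi fun x hx ↦ by have hx : (0 : ℝ) < x := hx; positivity
  have hC₂ : 0 ≤ ∫ x in Ioi (0 : ℝ), x ^ A * (Real.exp (-x) * (2 ^ j * (1 + |Real.log x| ^ j))) :=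
    setIntegral_nonneg measurableSet_Ioi fun x hx ↦ by have hx : (0 : ℝ) < x := hx; positivity
  have hy : 0 ≤ (qh ^ 2 / ((n₁ : ℝ) * n₂)) ^ A := Real.rpow_nonneg (by positivity) A
  have hL : 0 ≤ 1 + Real.log qh := by linarith [Real.log_nonneg hqh]
  have g₁ := one_add_log_pow_le_rpow hε i hn₁1
  have g₂ := one_add_log_pow_le_rpow hε j hn₂1
  have g0₁ : 0 ≤ (1 + Real.log (n₁ : ℝ)) ^ i := pow_nonneg (by linarith [Real.log_nonneg hn₁1]) i
  have g0₂ : 0 ≤ (1 + Real.log (n₂ : ℝ)) ^ j := pow_nonneg (by linarith [Real.log_nonneg hn₂1]) j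
  have hprod : (1 + Real.log (n₁ : ℝ)) ^ i * (1 + Real.log (n₂ : ℝ)) ^ j ≤
      (1 + ε⁻¹) ^ (i + j) * ((n₁ : ℝ) ^ (ε * i) * (n₂ : ℝ) ^ (ε * j)) := by
    calc (1 + Real.log (n₁ : ℝ)) ^ i * (1 + Real.log (n₂ : ℝ)) ^ j
        ≤ ((1 + ε⁻¹) ^ i * (n₁ : ℝ) ^ (ε * i)) * ((1 + ε⁻¹) ^ j * (n₂ : ℝ) ^ (ε * j)) :=
          mul_le_mul g₁ g₂ g0₂ (g0₁.trans g₁)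
      _ = (1 + ε⁻¹) ^ (i + j) * ((n₁ : ℝ) ^ (ε * i) * (n₂ : ℝ) ^ (ε * j)) := by rw [pow_add]; ring
  set K : ℝ := ((∫ x in Ioi (0 : ℝ), x ^ A * (Real.exp (-x) * (2 ^ i * (1 + |Real.log x| ^ i)))) *
    ∫ x in Ioi (0 : ℝ), x ^ A * (Real.exp (-x) * (2 ^ j * (1 + |Real.log x| ^ j)))) with hK
  have hK0 : 0 ≤ K := mul_nonneg hC₁ hC₂
  calc ‖afeW qh i j n₁ n₂‖ ≤ K * (qh ^ 2 / ((n₁ : ℝ) * n₂)) ^ A *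
        ((1 + Real.log qh) ^ (i + j) * (1 + Real.log n₁) ^ i * (1 + Real.log n₂) ^ j) := h
    _ = (K * (qh ^ 2 / ((n₁ : ℝ) * n₂)) ^ A * (1 + Real.log qh) ^ (i + j)) *
        ((1 + Real.log (n₁ : ℝ)) ^ i * (1 + Real.log (n₂ : ℝ)) ^ j) := by ring
    _ ≤ (K * (qh ^ 2 / ((n₁ : ℝ) * n₂)) ^ A * (1 + Real.log qh) ^ (i + j)) *
        ((1 + ε⁻¹) ^ (i + j) * ((n₁ : ℝ) ^ (ε * i) * (n₂ : ℝ) ^ (ε * j))) :=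
          mul_le_mul_of_nonneg_left hprod (mul_nonneg (mul_nonneg hK0 hy) (pow_nonneg hL _))
    _ = _ := by ring

end Summit.Parity.GeneralizedHardyLittlewood.Theorems.MomentsBeyondDiagonal.TwoOrderAFE

end
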